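import Literature.Topology.FourManifolds.SurfaceGroupHomology
import Mathlib.RingTheory.OrzechProperty
import Mathlib.RingTheory.FiniteType
import Mathlib.LinearAlgebra.Pi
import Mathlib.LinearAlgebra.StdBasis
import HarnessLib

/-!
# Unimodularity of the intersection form and Lagrangian kernels of split surjections

Topic `Literature/Topology/FourManifolds`; theorems only, over `SurfaceGroupHomology.lean`
(`symplForm` = the intersection form `ν` on `ι × Bool → ℤ`).

* `exists_symplForm_eq` — **unimodularity** of `ν` (ZVC 3.6.5, the matrix `K` has determinant
  `1`), made explicit: every linear functional on `ℤ^{ι × Bool}` is `ν(w, ·)`; the coordinates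
  of the dual vector (`apply_false/true_of_symplForm_eq`) and `symplForm_of_symplForm_eq`
  (duals pair as the coefficient rows of the functionals do);
* `symplForm_ker_of_section` — if `R : ℤ^{ι × Bool} → ℤ^κ` has a linear section, its coefficient
  rows are pairwise `ν`-orthogonal, and `ℤ^κ × ℤ^κ ≅ ℤ^{ι × Bool}` (the rank condition), then
  `ker R` is LAGRANGIAN: isotropic and equal to its `ν`-orthogonal.  (The algebraic form of
  "`H₁` of a handlebody bounded by `Σ_g` has Lagrangian kernel"; the rank condition replaces a
  dimension count, the section replaces torsion-freeness of the cokernel.)  Proof: the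
  `ν`-duals of the rows span an isotropic `T(ℤ^κ) ≤ ker R`, and `(y, z) ↦ T y + U z` has an
  explicit left inverse, hence is bijective by the Orzech–Vasconcelos theorem (a surjective
  endomorphism of a finitely generated module is injective), so `ker R = T(ℤ^κ)`.

## References

* H. Zieschang, E. Vogt, H.-D. Coldewey, *Surfaces and Planar Discontinuous Groups*, LNM 835,
  Springer (1980), 3.6.5–3.6.7. [ZieschangVogtColdewey1980]
-/

noncomputable section

namespace Literature.Topology.FourManifolds

open Finset

section Dual

variable {ι : Type*} [Fintype ι] [DecidableEq ι]

/-- **Unimodularity of the intersection form**, explicitly: every linear functional on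
`ℤ^{ι × Bool}` is `ν(w, ·)` for an (explicit) vector `w`. [cite: ZieschangVogtColdewey1980, 3.6.5] -/
theorem exists_symplForm_eq (φ : (ι × Bool → ℤ) →ₗ[ℤ] ℤ) :
    ∃ w : ι × Bool → ℤ, ∀ x, symplForm w x = φ x := by
  refine ⟨fun y => if y.2 = true then -φ (Pi.single (y.1, false) 1) else φ (Pi.single (y.1, true) 1),
    fun x => ?_⟩
  have hx : x = ∑ y : ι × Bool, x y • (Pi.single y (1 : ℤ) : ι × Bool → ℤ) := by
    conv_lhs => rw [← Finset.univ_sum_single x]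
    refine Finset.sum_congr rfl fun y _ => ?_
    ext z
    simp [Pi.single_apply]
  conv_rhs => rw [hx, map_sum]
  rw [symplForm_apply, Fintype.sum_prod_type]
  refine Finset.sum_congr rfl fun i _ => ?_
  simp only [Fintype.sum_bool, map_zsmul, smul_eq_mul, if_true, Bool.false_eq_true, if_false]
  ring

/-- The coordinates of a `ν`-dual vector: `w(aᵢ) = φ(δ_{bᵢ})`. [folklore] -/
theorem apply_false_of_symplForm_eq {φ : (ι × Bool → ℤ) →ₗ[ℤ] ℤ} {w : ι × Bool → ℤ}
    (hw : ∀ x, symplForm w x = φ x) (i : ι) : w (i, false) = φ (Pi.single (i, true) 1) := by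
  rw [← hw, symplForm_single_true_right, mul_one]

/-- The coordinates of a `ν`-dual vector: `w(bᵢ) = -φ(δ_{aᵢ})`. [folklore] -/
theorem apply_true_of_symplForm_eq {φ : (ι × Bool → ℤ) →ₗ[ℤ] ℤ} {w : ι × Bool → ℤ}
    (hw : ∀ x, symplForm w x = φ x) (i : ι) : w (i, true) = -φ (Pi.single (i, false) 1) := by
  rw [← hw, symplForm_single_false_right, mul_one, neg_neg]

/-- Dual vectors pair as the functionals' coefficient rows do:
`ν(w, w') = ν(row φ, row φ')` where `row φ = (φ(δ_x))_x`. [folklore] -/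
theorem symplForm_of_symplForm_eq {φ φ' : (ι × Bool → ℤ) →ₗ[ℤ] ℤ} {w w' : ι × Bool → ℤ}
    (hw : ∀ x, symplForm w x = φ x) (hw' : ∀ x, symplForm w' x = φ' x) :
    symplForm w w' = symplForm (fun x => φ (Pi.single x 1)) (fun x => φ' (Pi.single x 1)) := by
  rw [symplForm_apply, symplForm_apply]
  refine Finset.sum_congr rfl fun i _ => ?_
  rw [apply_false_of_symplForm_eq hw, apply_true_of_symplForm_eq hw,
    apply_false_of_symplForm_eq hw', apply_true_of_symplForm_eq hw']
  ring

end Dual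

section Section

variable {ι κ : Type*} [Fintype ι] [DecidableEq ι] [Fintype κ] [DecidableEq κ]

/-- **The kernel of a split surjection with `ν`-isotropic rows and complementary rank is
Lagrangian.**  Let `R : ℤ^{ι × Bool} → ℤ^κ` be linear with a linear section `U` (`R ∘ U = id`),
suppose the coefficient rows `x ↦ R(δ_x)_c` are pairwise orthogonal for the intersection form
`ν`, and suppose `ℤ^κ × ℤ^κ ≅ ℤ^{ι × Bool}` (the rank condition `2|κ| = 2|ι|`, given as any linear
isomorphism `e`).  Then `ker R` is isotropic and equal to its own `ν`-orthogonal.  Proof: the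
`ν`-duals `t_c` of the rows span an isotropic submodule `T(ℤ^κ) ≤ ker R`; the map
`(y, z) ↦ T y + U z` has the explicit left inverse `x ↦ ((ν(x - URx, Ue_c))_c, Rx)`, which is
therefore a surjective endomorphism of a finitely generated module up to `e`, hence injective
(Orzech / Vasconcelos), so `ker R = T(ℤ^κ)`. [folklore] -/
theorem symplForm_ker_of_section (R : (ι × Bool → ℤ) →ₗ[ℤ] (κ → ℤ))
    (U : (κ → ℤ) →ₗ[ℤ] (ι × Bool → ℤ)) (hRU : ∀ y, R (U y) = y)
    (e : ((κ → ℤ) × (κ → ℤ)) ≃ₗ[ℤ] (ι × Bool → ℤ))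
    (hrows : ∀ c d : κ,
      symplForm (fun x => R (Pi.single x 1) c) (fun x => R (Pi.single x 1) d) = 0) :
    (∀ x ∈ LinearMap.ker R, ∀ y ∈ LinearMap.ker R, symplForm x y = 0) ∧
      ∀ x, (∀ y ∈ LinearMap.ker R, symplForm x y = 0) → x ∈ LinearMap.ker R := by
  -- the dual vectors of the rows
  have ht' : ∀ c : κ, ∃ w : ι × Bool → ℤ, ∀ x, symplForm w x = ((LinearMap.proj c).comp R) x :=
    fun c => exists_symplForm_eq _
  choose t ht₀ using ht'
  have ht : ∀ c x, symplForm (t c) x = R x c := fun c x => ht₀ c x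
  -- they are pairwise orthogonal and lie in `ker R`
  have htt : ∀ c d, symplForm (t c) (t d) = 0 := fun c d => by
    rw [symplForm_of_symplForm_eq (ht₀ c) (ht₀ d)]
    exact hrows c d
  have hRt : ∀ c, R (t c) = 0 := fun c => by
    funext d
    rw [← ht d (t c), htt, Pi.zero_apply]
  -- `T y = ∑ y_c t_c`
  set T : (κ → ℤ) →ₗ[ℤ] (ι × Bool → ℤ) := ∑ c, (LinearMap.proj c).smulRight (t c) with hT
  have hTapply : ∀ y, T y = ∑ c, y c • t c := fun y => by
    rw [hT, LinearMap.sum_apply]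
    rfl
  have hωT : ∀ y x, symplForm (T y) x = ∑ c, y c * R x c := fun y x => by
    rw [hTapply, map_sum, LinearMap.sum_apply]
    refine Finset.sum_congr rfl fun c _ => ?_
    rw [map_zsmul, LinearMap.smul_apply, ht, smul_eq_mul]
  have hRT : ∀ y, R (T y) = 0 := fun y => by
    rw [hTapply, map_sum]
    exact Finset.sum_eq_zero fun c _ => by rw [map_zsmul, hRt, smul_zero]
  -- the two-sided inverse
  set Φ : ((κ → ℤ) × (κ → ℤ)) →ₗ[ℤ] (ι × Bool → ℤ) := T.coprod U with hΦ
  set A : (ι × Bool → ℤ) →ₗ[ℤ] (κ → ℤ) :=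
    LinearMap.pi fun c => (symplForm.flip (U (Pi.single c 1))).comp (LinearMap.id - U.comp R)
    with hA
  have hAapply : ∀ x c, A x c = symplForm (x - U (R x)) (U (Pi.single c 1)) := fun x c => rfl
  set Ψ : (ι × Bool → ℤ) →ₗ[ℤ] ((κ → ℤ) × (κ → ℤ)) := A.prod R with hΨ
  have hΨΦ : ∀ p, Ψ (Φ p) = p := by
    rintro ⟨y, z⟩
    have hRyz : R (T y + U z) = z := by rw [map_add, hRT, zero_add, hRU]
    refine Prod.ext ?_ ?_
    · change A (T y + U z) = y
      funext c
      rw [hAapply, hRyz, add_sub_cancel_right, hωT]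
      rw [Finset.sum_eq_single c (fun d _ hd => by rw [hRU, Pi.single_eq_of_ne hd, mul_zero])
        (by simp)]
      rw [hRU, Pi.single_eq_same, mul_one]
    · change R (T y + U z) = z
      exact hRyz
  -- `Ψ` is injective: `e.symm ∘ ... ` hmm use the endomorphism `Φ ∘ e.symm`? We use `e ∘ Ψ`.
  have hsurj : Function.Surjective (e.toLinearMap.comp Ψ) := by
    intro x
    refine ⟨Φ (e.symm x), ?_⟩
    rw [LinearMap.comp_apply, hΨΦ, LinearEquiv.coe_coe, LinearEquiv.apply_symm_apply]
  have hinj : Function.Injective Ψ := by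
    have := OrzechProperty.injective_of_surjective_endomorphism (e.toLinearMap.comp Ψ) hsurj
    intro a b hab
    apply this
    rw [LinearMap.comp_apply, LinearMap.comp_apply, hab]
  have hΦΨ : ∀ x, Φ (Ψ x) = x := fun x => hinj (by rw [hΨΦ])
  have hker : ∀ x, R x = 0 → x = T (A x) := fun x hx => by
    conv_lhs => rw [← hΦΨ x]
    change T (A x) + U (R x) = T (A x)
    rw [hx, map_zero, add_zero]
  constructor
  · intro x hx y hy
    rw [LinearMap.mem_ker] at hx hy
    rw [hker x hx, hker y hy, hωT]
    refine Finset.sum_eq_zero fun c _ => ?_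
    rw [hRT, Pi.zero_apply, mul_zero]
  · intro x hx
    rw [LinearMap.mem_ker]
    funext c
    have := hx (t c) (by rw [LinearMap.mem_ker]; exact hRt c)
    rw [symplForm_comm, neg_eq_zero, ht] at this
    exact this

end Section

end Literature.Topology.FourManifolds

end
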